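import Summits.CriticalPhenomena.PercolationContinuityZ3.Theorems.PercNearOneGluingNoHeavyQuantDepthOneTripleHeavySingle
import Summits.CriticalPhenomena.PercolationContinuityZ3.Theorems.PercNearOneGluingNoHeavyQuantThreeRootGenericStep
import HarnessLib

/-!
# QUANT lane R8, T-DEC: THE GENERIC WIDTH-3 FOREST OF DEPTH-1 SIBLINGS IS SDEC ON ITS REGION, ORACLE-FREE — arm-1 g46's
# `sdec_threeRootGeneric_of_opened` with the opened pair and the two opened hubs discharged by blob tools and the width-2 theorem of
# `…QuantGluedPairSDEC`; corollary: every identical depth-1 triple (e.g. `(R^r[q](R^k[g]))³`, ANY shape) is SDEC at every floor `≤ q²·y`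
# (prim-quant-census-2 gen 79)

builds on p205010 (kernel theorem, internal audit signed; external expert review pending)

Support file (`--supports stmt-CriticalPhenomena-4575`), QUANT lane census seat prim-quant-census-2 (gen 79); memo
`run/shared/lean/prim/quant/prim-quant-census-2-g79/GLUEDPAIR-G79.md` §6.  Theorems only, standard axioms, no sorries, no definitions.

THE STEP (arm-1 g46): pair `(1,2)` with `0 < q₂ ≤ q₁ < 1`, single `0 < q₃ ≤ Q = q₁+q₂−q₁q₂`, re-gates `l₂ = q₂(R₂ − (1−q₁)R₁)/(QR₂)`, `l₁ = q₁(R₁ − (1−q₂)R₂)/(QR₁)`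
(positivity `(1−q₁)R₁ ≤ R₂`, `(1−q₂)R₂ ≤ R₁`); inputs: SDEC of the sub-forests, of the opened pair `ρ₁ ∗ gate_{q₂/q₁}ρ₂`, and of the opened hubs
`G₁ = ρ₁ ∗ gate_{l₂}ρ₂ ∗ gate_{q₃/Q}ρ₃`, `G₂ = gate_{l₁}ρ₁ ∗ ρ₂ ∗ gate_{q₃/Q}ρ₃`; conclusion SDEC at `x ≤ min(qᵢyᵢ, q₁w₁₂, Qv₁, Qv₂)`.  For DEPTH-1 siblings
(`ρᵢ ∈ K_{yᵢ}(Rᵢ)`, `yᵢMᵢ ≤ Rᵢ`) each hub is a blob-hull law beside a WIDTH-2 forest of gated depth-1 trees — `sdec_two_of_subBlobHull` + `sdec_lconv_inBlobHull`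
(+ `lconv_assoc` / `lconv_lconv_swap` bookkeeping) — at the floor `v = x/Q`; the opened pair is `sdec_gate_lconv_of_subBlobHull` at `x/q₁`.
* **`sdec_three_generic_of_subBlobHull`** — hypotheses: hull memberships, `yᵢMᵢ ≤ Rᵢ`, `0 < R₁, R₂`, `0 < q₂ ≤ q₁ < 1`, `0 < q₃ < Q` (strict, so that every
  gated factor has a gate `< 1`), positivity, and the floor in product form `0 < x ≤ qᵢyᵢ`, `x·R₂ ≤ q₂(R₂ − (1−q₁)R₁)·y₂`, `x·R₁ ≤ q₁(R₁ − (1−q₂)R₂)·y₁`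
  (`= x ≤ Q l₂ y₂`, `x ≤ Q l₁ y₁`: the two pair boxes' slack — NOT the true floor); conclusion `SDEC x (M₁+M₂+M₃) ((gate ρ₁ q₁ ∗ gate ρ₂ q₂) ∗ gate ρ₃ q₃)`.
* **`sdec_three_identical_of_subBlobHull`** — three copies of ONE depth-1 sibling `gate ρ q` (`ρ ∈ K_y(R)`, `yM ≤ R`, `0 < q < 1`): SDEC at every
  `0 < x ≤ q²·y` (the slack floor of the generic step for equal gates: `Q l = q²`); e.g. the identical glued triple `(R^r[q](R^k[g]))³`, ANY shape
  `(r, k)` with `r + k ≥ 1` — long tails included — at every floor `≤ q²g` (`sdec_gluedThree_identical`).  The TRUE floor `qg` for long tails `k > 2r` at width 3 stays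
  open (census-1 g31/g32: `K ≤ 2lo` closed at every width).

HONEST STATUS.  Region results (floor slack); `SiblingStep`, `FarTreeRow` OPEN; RATE class (log\*) / honest sentence of `run/shared/lean/prim/quant/README.md`
unchanged.  [this work]; the step is prim-quant-arm-1 g46's.  Nothing here is cited as a published result.  The gluing rows served
[cite: KozmaNitzan2024, Conjecture 3 (p. 15)]; product measure [cite: Grimmett1999, §1.3 p. 10].
-/

noncomputable section

open scoped BigOperators

namespace Summit.CriticalPhenomena.PercolationContinuityZ3.Theorems
namespace Quant
namespace LawDec

open Finset

/-- a width-2 forest of gated depth-1 trees beside a blob-hull law is SDEC: `σa ∈ K_{ya}`, `σb ∈ K_{yb}`, `ν ∈ K_{yν}`, gates `0 < ca, cb < 1`, floor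
`0 < v ≤ min(ca·ya, cb·yb, yν)` (with `ya·Ma ≤ ma`, `yb·Mb ≤ mb`) ⟹ `SDEC v ((Ma+Mb)+N) ((gate σa ca ∗ gate σb cb) ∗ ν)`. [this work] -/
theorem sdec_gatedTwo_lconv_of_subBlobHull {ya ma yb mb yν mν ca cb v : ℝ} {Ma Mb N : ℕ} {σa σb ν : ℕ → ℝ}
    (hya0 : 0 < ya) (hya1 : ya < 1) (hyb0 : 0 < yb) (hyb1 : yb < 1) (hyν0 : 0 < yν)
    (hσa : InBlobHull ya ma Ma σa) (hσb : InBlobHull yb mb Mb σb) (hν : InBlobHull yν mν N ν)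
    (htaa : ya * (Ma : ℝ) ≤ ma) (htab : yb * (Mb : ℝ) ≤ mb) (hca0 : 0 < ca) (hca1 : ca < 1) (hcb0 : 0 < cb) (hcb1 : cb < 1)
    (hv0 : 0 < v) (hva : v ≤ ca * ya) (hvb : v ≤ cb * yb) (hvν : v ≤ yν) :
    SDEC v ((Ma + Mb) + N) (lconv (Ma + Mb) N (lconv Ma Mb (gate σa ca) (gate σb cb)) ν) := by
  have hv1 : v < 1 := by
    have : ca * ya < 1 := by nlinarith
    linarith
  have hF : SDEC v (Ma + Mb) (lconv Ma Mb (gate σa ca) (gate σb cb)) :=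
    sdec_two_of_subBlobHull hya0 hya1 hyb0 hyb1 hca0 hca1 hcb0 hcb1 hσa hσb htaa htab hv0 hva hvb
  obtain ⟨f0, fM, f1, fmn⟩ := gatedTwo_laws hya0.le hyb0.le hσa hσb hca0.le hca1.le hcb0.le hcb1.le
  have hta : v * ((Ma + Mb : ℕ) : ℝ) ≤ ∑ h ∈ Finset.range (Ma + Mb + 1), (h : ℝ) * lconv Ma Mb (gate σa ca) (gate σb cb) h := by
    rw [fmn]
    have h1 : v * (Ma : ℝ) ≤ ca * ya * Ma := mul_le_mul_of_nonneg_right hva (Nat.cast_nonneg Ma)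
    have h2 : v * (Mb : ℝ) ≤ cb * yb * Mb := mul_le_mul_of_nonneg_right hvb (Nat.cast_nonneg Mb)
    have h3 : ca * (ya * (Ma : ℝ)) ≤ ca * ma := mul_le_mul_of_nonneg_left htaa hca0.le
    have h4 : cb * (yb * (Mb : ℝ)) ≤ cb * mb := mul_le_mul_of_nonneg_left htab hcb0.le
    have e : v * ((Ma + Mb : ℕ) : ℝ) = v * (Ma : ℝ) + v * (Mb : ℝ) := by push_cast; ring
    have e3 : ca * ya * (Ma : ℝ) = ca * (ya * (Ma : ℝ)) := by ring
    have e4 : cb * yb * (Mb : ℝ) = cb * (yb * (Mb : ℝ)) := by ring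
    rw [e]; linarith
  have _ := hyν0
  exact sdec_lconv_inBlobHull hv0 hv1 f0 fM f1 hta hF (hν.mono hvν le_rfl)

/-- **THE GENERIC WIDTH-3 FOREST OF DEPTH-1 SIBLINGS ON ITS REGION — NO ORACLE** (see the module docstring for the hypotheses). [this work] -/
theorem sdec_three_generic_of_subBlobHull {y₁ y₂ y₃ R₁ R₂ R₃ q₁ q₂ q₃ x : ℝ} {M₁ M₂ M₃ : ℕ} {ρ₁ ρ₂ ρ₃ : ℕ → ℝ}
    (hy₁0 : 0 < y₁) (hy₁1 : y₁ < 1) (hy₂0 : 0 < y₂) (hy₂1 : y₂ < 1) (hy₃0 : 0 < y₃) (hy₃1 : y₃ < 1)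
    (hρ₁ : InBlobHull y₁ R₁ M₁ ρ₁) (hρ₂ : InBlobHull y₂ R₂ M₂ ρ₂) (hρ₃ : InBlobHull y₃ R₃ M₃ ρ₃)
    (hta₁ : y₁ * (M₁ : ℝ) ≤ R₁) (hta₂ : y₂ * (M₂ : ℝ) ≤ R₂) (hta₃ : y₃ * (M₃ : ℝ) ≤ R₃) (hR₁0 : 0 < R₁) (hR₂0 : 0 < R₂)
    (hq₂0 : 0 < q₂) (hq₂₁ : q₂ ≤ q₁) (hq₁1 : q₁ < 1) (hq₃0 : 0 < q₃) (hq₃Q : q₃ < q₁ + q₂ - q₁ * q₂)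
    (hpos₂ : (1 - q₁) * R₁ ≤ R₂) (hpos₁ : (1 - q₂) * R₂ ≤ R₁)
    (hx0 : 0 < x) (hx₁ : x ≤ q₁ * y₁) (hx₂ : x ≤ q₂ * y₂) (hx₃ : x ≤ q₃ * y₃)
    (hxl₂ : x * R₂ ≤ q₂ * (R₂ - (1 - q₁) * R₁) * y₂) (hxl₁ : x * R₁ ≤ q₁ * (R₁ - (1 - q₂) * R₂) * y₁) :
    SDEC x (M₁ + M₂ + M₃) (lconv (M₁ + M₂) M₃ (lconv M₁ M₂ (gate ρ₁ q₁) (gate ρ₂ q₂)) (gate ρ₃ q₃)) := by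
  have hq₁0 : 0 < q₁ := lt_of_lt_of_le hq₂0 hq₂₁
  set Q : ℝ := q₁ + q₂ - q₁ * q₂ with hQ
  have hq₂1 : q₂ < 1 := lt_of_le_of_lt hq₂₁ hq₁1
  have hA : 0 ≤ q₂ * (1 - q₁) := mul_nonneg hq₂0.le (by linarith)
  have hB : 0 < q₁ * (1 - q₂) := mul_pos hq₁0 (by linarith)
  have hQq₁ : q₁ ≤ Q := by rw [hQ]; linarith
  have hQq₂ : q₂ < Q := by rw [hQ]; linarith
  have hQ0 : 0 < Q := lt_trans hq₂0 hQq₂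
  have hQ1 : Q < 1 := by
    have : 0 < (1 - q₁) * (1 - q₂) := mul_pos (by linarith) (by linarith)
    rw [hQ]; linarith
  have hq₃1 : q₃ < 1 := lt_trans hq₃Q hQ1
  obtain ⟨a0, aM, a1⟩ := hρ₁.lawFacts hy₁0.le
  obtain ⟨b0, bM, b1⟩ := hρ₂.lawFacts hy₂0.le
  obtain ⟨c0, cM, c1⟩ := hρ₃.lawFacts hy₃0.le
  have hS₁ : SDEC y₁ M₁ ρ₁ := sdec_of_inBlobHull hy₁0 hy₁1 hρ₁
  have hS₂ : SDEC y₂ M₂ ρ₂ := sdec_of_inBlobHull hy₂0 hy₂1 hρ₂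
  have hS₃ : SDEC y₃ M₃ ρ₃ := sdec_of_inBlobHull hy₃0 hy₃1 hρ₃
  -- the re-gates
  set l₂ : ℝ := q₂ * (R₂ - (1 - q₁) * R₁) / (Q * R₂) with hl₂
  set l₁ : ℝ := q₁ * (R₁ - (1 - q₂) * R₂) / (Q * R₁) with hl₁
  have hQR₂ : 0 < Q * R₂ := mul_pos hQ0 hR₂0
  have hQR₁ : 0 < Q * R₁ := mul_pos hQ0 hR₁0
  have hxR₂ : 0 < x * R₂ := mul_pos hx0 hR₂0
  have hxR₁ : 0 < x * R₁ := mul_pos hx0 hR₁0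
  have hn₂ : 0 < q₂ * (R₂ - (1 - q₁) * R₁) := by
    by_contra hc
    push Not at hc
    have : q₂ * (R₂ - (1 - q₁) * R₁) * y₂ ≤ 0 := by nlinarith
    linarith
  have hn₁ : 0 < q₁ * (R₁ - (1 - q₂) * R₂) := by
    by_contra hc
    push Not at hc
    have : q₁ * (R₁ - (1 - q₂) * R₂) * y₁ ≤ 0 := by nlinarith
    linarith
  have hl₂0 : 0 < l₂ := div_pos hn₂ hQR₂
  have hl₁0 : 0 < l₁ := div_pos hn₁ hQR₁
  have hA₁ : 0 ≤ q₂ * (1 - q₁) * R₁ := mul_nonneg hA hR₁0.le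
  have hB₂ : 0 < q₁ * (1 - q₂) * R₂ := mul_pos hB hR₂0
  have hA₂ : 0 ≤ q₂ * (1 - q₁) * R₂ := mul_nonneg hA hR₂0.le
  have hB₁ : 0 < q₁ * (1 - q₂) * R₁ := mul_pos hB hR₁0
  have hl₂1 : l₂ < 1 := by
    rw [hl₂, div_lt_one hQR₂]
    have e1 : q₂ * (R₂ - (1 - q₁) * R₁) = q₂ * R₂ - q₂ * (1 - q₁) * R₁ := by ring
    have e2 : Q * R₂ = q₂ * R₂ + q₁ * (1 - q₂) * R₂ := by rw [hQ]; ring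
    rw [e1, e2]; linarith
  have hl₁1 : l₁ < 1 := by
    rw [hl₁, div_lt_one hQR₁]
    have e1 : q₁ * (R₁ - (1 - q₂) * R₂) = q₁ * R₁ - q₁ * (1 - q₂) * R₂ := by ring
    have e2 : Q * R₁ = q₁ * R₁ + q₂ * (1 - q₁) * R₁ := by rw [hQ]; ring
    rw [e1, e2]; linarith
  -- opened floors
  set w : ℝ := x / q₁ with hw
  set v : ℝ := x / Q with hv
  have hw0 : 0 < w := div_pos hx0 hq₁0
  have hv0 : 0 < v := div_pos hx0 hQ0
  have hwy₁ : w ≤ y₁ := by rw [hw, div_le_iff₀ hq₁0]; linarith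
  have hw1 : w < 1 := lt_of_le_of_lt hwy₁ hy₁1
  have hvy₁ : v ≤ y₁ := by
    have : q₁ * y₁ ≤ Q * y₁ := mul_le_mul_of_nonneg_right hQq₁ hy₁0.le
    rw [hv, div_le_iff₀ hQ0]; linarith
  have hvy₂ : v ≤ y₂ := by
    have : q₂ * y₂ ≤ Q * y₂ := mul_le_mul_of_nonneg_right hQq₂.le hy₂0.le
    rw [hv, div_le_iff₀ hQ0]; linarith
  have hv1 : v < 1 := lt_of_le_of_lt hvy₁ hy₁1
  have hxw : x ≤ q₁ * w := by rw [hw, mul_div_cancel₀ _ hq₁0.ne']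
  have hxv : x ≤ Q * v := by rw [hv, mul_div_cancel₀ _ hQ0.ne']
  -- (1) opened pair at w
  have hG₁₂ : SDEC w (M₁ + M₂) (lconv M₁ M₂ ρ₁ (gate ρ₂ (q₂ / q₁))) := by
    have hc0 : 0 < q₂ / q₁ := div_pos hq₂0 hq₁0
    have hc1 : q₂ / q₁ ≤ 1 := (div_le_one hq₁0).2 hq₂₁
    have hwc : w ≤ q₂ / q₁ * y₂ := by
      rw [hw, div_mul_eq_mul_div, div_le_div_iff_of_pos_right hq₁0]; exact hx₂
    have := sdec_gate_lconv_of_subBlobHull hy₂0 hy₂1 hy₁0 hρ₂ hρ₁ hta₂ hc0 hc1 hw0 hw1 hwc hwy₁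
    rwa [lconv_comm, Nat.add_comm M₂ M₁] at this
  have htaG₁₂ : w * ((M₁ + M₂ : ℕ) : ℝ) ≤ R₁ + q₂ / q₁ * R₂ := by
    have h1 : w * (M₁ : ℝ) ≤ y₁ * M₁ := mul_le_mul_of_nonneg_right hwy₁ (Nat.cast_nonneg M₁)
    have hwc : w ≤ q₂ / q₁ * y₂ := by
      rw [hw, div_mul_eq_mul_div, div_le_div_iff_of_pos_right hq₁0]; exact hx₂
    have h2 : w * (M₂ : ℝ) ≤ q₂ / q₁ * y₂ * M₂ := mul_le_mul_of_nonneg_right hwc (Nat.cast_nonneg M₂)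
    have h3 : q₂ / q₁ * (y₂ * (M₂ : ℝ)) ≤ q₂ / q₁ * R₂ := mul_le_mul_of_nonneg_left hta₂ (div_pos hq₂0 hq₁0).le
    have e : w * ((M₁ + M₂ : ℕ) : ℝ) = w * (M₁ : ℝ) + w * (M₂ : ℝ) := by push_cast; ring
    have e2 : q₂ / q₁ * y₂ * (M₂ : ℝ) = q₂ / q₁ * (y₂ * (M₂ : ℝ)) := by ring
    rw [e]; linarith
  -- (2) the single's re-gate q₃/Q and the hub floors
  have hc₃0 : 0 < q₃ / Q := div_pos hq₃0 hQ0
  have hc₃1 : q₃ / Q < 1 := (div_lt_one hQ0).2 hq₃Q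
  have hv₃ : v ≤ q₃ / Q * y₃ := by rw [hv, div_mul_eq_mul_div, div_le_div_iff_of_pos_right hQ0]; exact hx₃
  have hvl₂ : v ≤ l₂ * y₂ := by
    have e : l₂ * y₂ = (q₂ * (R₂ - (1 - q₁) * R₁) * y₂ / R₂) / Q := by
      rw [hl₂]; field_simp
    rw [hv, e]
    exact div_le_div_of_nonneg_right ((le_div_iff₀ hR₂0).2 hxl₂) hQ0.le
  have hvl₁ : v ≤ l₁ * y₁ := by
    have e : l₁ * y₁ = (q₁ * (R₁ - (1 - q₂) * R₂) * y₁ / R₁) / Q := by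
      rw [hl₁]; field_simp
    rw [hv, e]
    exact div_le_div_of_nonneg_right ((le_div_iff₀ hR₁0).2 hxl₁) hQ0.le
  -- G₁ = ρ₁ ∗ gate_{l₂}ρ₂ ∗ gate_{q₃/Q}ρ₃
  have hG₁ : SDEC v (M₁ + M₂ + M₃) (lconv (M₁ + M₂) M₃ (lconv M₁ M₂ ρ₁ (gate ρ₂ l₂)) (gate ρ₃ (q₃ / Q))) := by
    have h := sdec_gatedTwo_lconv_of_subBlobHull hy₂0 hy₂1 hy₃0 hy₃1 hy₁0 hρ₂ hρ₃ hρ₁ hta₂ hta₃ hl₂0 hl₂1 hc₃0 hc₃1 hv0 hvl₂ hv₃ hvy₁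
    rw [lconv_comm, lconv_assoc] at h
    have e : M₂ + M₃ + M₁ = M₁ + M₂ + M₃ := by omega
    rwa [e] at h
  -- G₂ = gate_{l₁}ρ₁ ∗ ρ₂ ∗ gate_{q₃/Q}ρ₃
  have hG₂ : SDEC v (M₁ + M₂ + M₃) (lconv (M₁ + M₂) M₃ (lconv M₁ M₂ (gate ρ₁ l₁) ρ₂) (gate ρ₃ (q₃ / Q))) := by
    have h := sdec_gatedTwo_lconv_of_subBlobHull hy₁0 hy₁1 hy₃0 hy₃1 hy₂0 hρ₁ hρ₃ hρ₂ hta₁ hta₃ hl₁0 hl₁1 hc₃0 hc₃1 hv0 hvl₁ hv₃ hvy₂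
    have eL : lconv (M₁ + M₃) M₂ (lconv M₁ M₃ (gate ρ₁ l₁) (gate ρ₃ (q₃ / Q))) ρ₂
        = lconv (M₁ + M₂) M₃ (lconv M₁ M₂ (gate ρ₁ l₁) ρ₂) (gate ρ₃ (q₃ / Q)) := by
      rw [lconv_comm]
      funext n
      exact lconv_lconv_swap M₁ M₂ M₃ (gate ρ₁ l₁) ρ₂ (gate ρ₃ (q₃ / Q)) n
    rw [eL] at h
    have e : M₁ + M₃ + M₂ = M₁ + M₂ + M₃ := by omega
    rwa [e] at h
  exact sdec_threeRootGeneric_of_opened y₁ y₂ y₃ w v v x q₁ q₂ q₃ Q R₁ R₂ R₃ l₁ l₂ M₁ M₂ M₃ ρ₁ ρ₂ ρ₃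
    hy₁0 hy₁1 hy₂0 hy₂1 hy₃0 hy₃1 hw0.le hw1 hv0.le hv1 hv0.le hv1 hq₂0 hq₂₁ hq₁1 hq₃0 hq₃1 hQ hq₃Q.le hx0
    a0 aM a1 hρ₁.mean_eq hta₁ hR₁0 b0 bM b1 hρ₂.mean_eq hta₂ hR₂0 c0 cM c1 hρ₃.mean_eq hta₃ hS₁ hS₂ hS₃ hl₂ hl₁ hpos₂ hpos₁
    hG₁₂ htaG₁₂ hG₁ hG₂ hx₁ hx₂ hx₃ hxw hxv hxv

/-- **THREE COPIES OF ONE DEPTH-1 SIBLING ARE SDEC AT EVERY FLOOR `≤ q²·y`** (`ρ ∈ K_y(R)` on `{0..M}`, `yM ≤ R`, `0 < R`, `0 < q < 1`): the generic step for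
equal gates (`Q·l = q²`). [this work] -/
theorem sdec_three_identical_of_subBlobHull {y R q x : ℝ} {M : ℕ} {ρ : ℕ → ℝ} (hy0 : 0 < y) (hy1 : y < 1) (hρ : InBlobHull y R M ρ)
    (hta : y * (M : ℝ) ≤ R) (hR0 : 0 < R) (hq0 : 0 < q) (hq1 : q < 1) (hx0 : 0 < x) (hx : x ≤ q ^ 2 * y) :
    SDEC x (M + M + M) (lconv (M + M) M (lconv M M (gate ρ q) (gate ρ q)) (gate ρ q)) := by
  have hxq : x ≤ q * y := by nlinarith [mul_pos hq0 hy0]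
  have hqQ : q < q + q - q * q := by nlinarith
  have hpos : (1 - q) * R ≤ R := by nlinarith
  have hxl : x * R ≤ q * (R - (1 - q) * R) * y := by
    have e : q * (R - (1 - q) * R) * y = q ^ 2 * y * R := by ring
    rw [e]; exact mul_le_mul_of_nonneg_right hx hR0.le
  exact sdec_three_generic_of_subBlobHull hy0 hy1 hy0 hy1 hy0 hy1 hρ hρ hρ hta hta hta hR0 hR0 hq0 le_rfl hq1 hq0 hqQ hpos hpos
    hx0 hxq hxq hxq hxl hxl

/-- **THE IDENTICAL GLUED TRIPLE `(R^r[q](R^k[g]))³`, ANY SHAPE, IS SDEC AT EVERY FLOOR `≤ q²g`** (no oracle; long tails `k > 2r` included — at width 3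
the true floor `qg` is known only for `k ≤ 2r`, census-1 g31/g32). [this work] -/
theorem sdec_gluedThree_identical (r k : ℕ) (hrk : 1 ≤ r + k) {q g x : ℝ} (hq0 : 0 < q) (hq1 : q < 1) (hg0 : 0 < g) (hg1 : g < 1)
    (hx0 : 0 < x) (hx : x ≤ q ^ 2 * g) :
    SDEC x ((r + k) + (r + k) + (r + k))
      (lconv ((r + k) + (r + k)) (r + k) (lconv (r + k) (r + k) (gate (blobLaw [(k, g), (r, 1)]) q) (gate (blobLaw [(k, g), (r, 1)]) q))
        (gate (blobLaw [(k, g), (r, 1)]) q)) := by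
  have hl : ∀ p ∈ [((k : ℕ), g), (r, (1 : ℝ))], g ≤ p.2 ∧ p.2 ≤ 1 := by
    intro p hp
    simp only [List.mem_cons, List.mem_nil_iff, or_false] at hp
    rcases hp with rfl | rfl
    · exact ⟨le_rfl, hg1.le⟩
    · exact ⟨hg1.le, le_rfl⟩
  have h := inBlobHull_blobLaw g [((k : ℕ), g), (r, (1 : ℝ))] hl (M := r + k) (by rw [blobTop_glued])
  have em : blobMean [((k : ℕ), g), (r, (1 : ℝ))] = (r : ℝ) + k * g := by simp [blobMean]
  rw [em] at h
  have hr0 : (0 : ℝ) ≤ r := Nat.cast_nonneg r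
  have hta : g * ((r + k : ℕ) : ℝ) ≤ (r : ℝ) + k * g := by
    push_cast
    have : g * (r : ℝ) ≤ r := by nlinarith
    linarith
  have hR0 : 0 < (r : ℝ) + k * g := by
    have h1 : (1 : ℝ) ≤ ((r + k : ℕ) : ℝ) := by exact_mod_cast hrk
    have h2 : g * 1 ≤ g * ((r + k : ℕ) : ℝ) := mul_le_mul_of_nonneg_left h1 hg0.le
    linarith
  exact sdec_three_identical_of_subBlobHull hg0 hg1 h hta hR0 hq0 hq1 hx0 hx

end LawDec
end Quant
end Summit.CriticalPhenomena.PercolationContinuityZ3.Theorems
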